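import Mathlib
import HarnessLib

/-!
# Route `CMKolyvaginAtInertTwo`, crux `CMKolyvaginExactAtInertTwo` (stmt-BirchSwinnertonDyer-24277):
# the `2^L`-torsion of a group with finite `2`-primary part of order dividing `2^L` IS the `2`-primary part
# (bridge from the assembly's `#Ш(E)[2^L]` to the count identity's `#Ш(E)[2^∞]`)

Seat `bsd-line-cmk2-p1` g17 (cell `bsd-print-cf2`); helper (`--supports stmt-BirchSwinnertonDyer-24277`).
THEOREMS ONLY (pure algebra, Mathlib): no definition, no named fact, no `sorry`; no item is closed; BSD is not
proved by this.

The path-(β) assembly (`card_mul_card_le_two_pow_two_mul_of_pairData(_canonical/_cmInert)`, this seat) outputs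
`#Ш(E)[2^L] · #Sel_{2^{2L}}(E^{(d_K)}) ≤ 2^{2M₀}`; the count identity / registered halves (g15–g16, p705380) speak of
`Nat.card (AddCommGroup.primaryComponent Ш 2)`. For `L ≥ v₂ #Ш[2^∞]` the two subgroups coincide:

* `torsionBy_two_pow_eq_primaryComponent` — `A[2^L] = A(2)` when `#A(2) ∣ 2^L` (`A(2)` finite);
* `natCard_torsionBy_two_pow_eq` — the cardinalities agree.

References: [McCallumLMS1991] §1 (the `2`-primary part of Ш); [MilneADT2006] I §6.
-/

-- single-conjunct summit: `Summit.BirchSwinnertonDyer.BirchSwinnertonDyer.…` repeats the name by design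
set_option linter.dupNamespace false
set_option autoImplicit false

open scoped AddSubgroup

namespace Summit.BirchSwinnertonDyer.BirchSwinnertonDyer.Theorems.KolyvaginPairDataTwo

/-- **`A[2^L] = A(2)`** for an additive commutative group `A` whose `2`-primary component `A(2)` is finite of
order dividing `2^L`: every `2^L`-torsion element has `2`-power order, and every element of `A(2)` has order
dividing `#A(2) ∣ 2^L`. [cite: McCallumLMS1991, §1 (Ш[p^∞] and its order)] -/
theorem torsionBy_two_pow_eq_primaryComponent {A : Type*} [AddCommGroup A] {L : ℕ}
    [Finite (AddCommGroup.primaryComponent A 2)]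
    (hL : Nat.card (AddCommGroup.primaryComponent A 2) ∣ 2 ^ L) :
    A[(2 ^ L : ℕ)] = AddCommGroup.primaryComponent A 2 := by
  ext x
  rw [AddSubgroup.torsionBy.nsmul_iff, AddCommGroup.mem_primaryComponent]
  constructor
  · exact fun h ↦ ⟨L, h⟩
  · rintro ⟨k, hk⟩
    have hx : x ∈ AddCommGroup.primaryComponent A 2 := AddCommGroup.mem_primaryComponent.mpr ⟨k, hk⟩
    have h1 : addOrderOf (⟨x, hx⟩ : AddCommGroup.primaryComponent A 2) ∣ 2 ^ L :=
      (addOrderOf_dvd_natCard _).trans hL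
    have h2 : addOrderOf x ∣ 2 ^ L := by
      rw [← AddSubgroup.addOrderOf_coe] at h1
      exact h1
    exact addOrderOf_dvd_iff_nsmul_eq_zero.mp h2

/-- **`#A[2^L] = #A(2)`** under the same hypothesis (the assembly's `#Ш(E)[2^L]` is `#Ш(E)[2^∞]` for
`L ≥ v₂ #Ш(E)[2^∞]`). [cite: McCallumLMS1991, §1 (Ш[p^∞] and its order)] -/
theorem natCard_torsionBy_two_pow_eq {A : Type*} [AddCommGroup A] {L : ℕ}
    [Finite (AddCommGroup.primaryComponent A 2)]
    (hL : Nat.card (AddCommGroup.primaryComponent A 2) ∣ 2 ^ L) :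
    Nat.card (A[(2 ^ L : ℕ)]) = Nat.card (AddCommGroup.primaryComponent A 2) := by
  rw [torsionBy_two_pow_eq_primaryComponent hL]

end Summit.BirchSwinnertonDyer.BirchSwinnertonDyer.Theorems.KolyvaginPairDataTwo
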